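import Literature.AlgebraicGeometry.Surfaces.K3ComplexMultiplication
import Literature.AlgebraicGeometry.HodgeTheory.ComplexOrientationFamily
import HarnessLib

/-!
# Real multiplication on K3 surfaces induced by algebraic cycles (van Geemen–Schütt 2025)

Family `hodge`, layer `Literature/AlgebraicGeometry/Surfaces`. B. van Geemen, M. Schütt, *On families
of K3 surfaces with real multiplication*, Forum Math. Sigma 13 (2025) e2 = arXiv:2310.05196 (v2;
held as `paper:arxiv-2310.05196`; numbering checked against the arXiv v2 HTML rendering).

For a complex projective K3 surface `X` with transcendental rational Hodge structure
`T_{X,ℚ} = Pic(X)^⊥ ⊗ ℚ` the endomorphism algebra `F = End_Hdg(T_{X,ℚ})` is a totally real or a CM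
field (Zarhin; loc. cit. §2.1); "a family of K3 surfaces has RM (or CM) by a field `F` if the very
general member `X` in the family has `F = End_Hdg(T_{X,ℚ})`" (§1). The paper exhibits explicit
families with REAL multiplication whose generator is induced by an explicit ALGEBRAIC CYCLE on
`X × X`:

* **Thm. 1.1** (`ρ` = Picard number of a very general member, `d = 22 - ρ = dim_ℚ T_{X,ℚ}`):
  "(5) The 7-dimensional family of degree 2 K3 surfaces in §5.9 has `ρ = 2` and RM by
  `ℚ(√5) = ℚ(ζ₅ + ζ₅⁻¹)`. (7) The 3-dimensional family of elliptic K3 surfaces in §5.4 has `ρ = 4` and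
  RM by the cubic field `ℚ(ζ₇ + ζ₇⁻¹)`. (9) The 2-dimensional family of elliptic K3 surfaces in §5.6 has
  `ρ = 10` and RM by the cubic field `ℚ(ζ₉ + ζ₉⁻¹)`. (11) The 2-dimensional family of elliptic K3
  surfaces in §5.8 has `ρ = 2` and RM by the degree five field `ℚ(ζ₁₁ + ζ₁₁⁻¹)`."
  Mechanism (Prop. 4.6, n ∈ {5, 7, 11}; §5.6 for n = 9): the Weierstrass fibration
  `𝓔_a : Y² = X³ + α(p_{n,a}(x))X + β(p_{n,a}(x))` (Dickson polynomial `p_{n,a}`, Lemma 4.3: the cover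
  `x ↦ p_{n,a}(x)` has monodromy `D_n`) is an elliptic K3 surface and `F = ℚ(ζ_n + ζ_n⁻¹)` acts by
  Hodge endomorphisms on `T_{𝓔_a}`: the pull-back `𝓔̃_a` along `x = v + a/v` carries the `D_n`-action
  `σ(X,Y,v) = (X,Y,ζ_n v)`, `τ(X,Y,v) = (X,Y,a/v)`, `𝓔̃_a/τ` is birational to `𝓔_a` and
  `σ^* + (σ⁻¹)^*` acts on `T_a ≅ T_{𝓔_a,ℚ}`. **§4.8 "Cycles inducing the real multiplication"**: with
  `Γ_k ⊂ 𝓔̃_a × 𝓔̃_a` the graph of `σ^k`, the Künneth component `[Γ_k]_2 = (σ^{-k})^*`, and "the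
  action of `ζ_n + ζ_n⁻¹` on `H²(𝓔̃_a, ℚ)` is induced by the cycle `Γ₁ + Γ₋₁` on `𝓔̃_a × 𝓔̃_a`. This
  cycle induces one on `𝓔_a × 𝓔_a` which defines the real multiplication on `T_{X,ℚ}`."
  §5.2 (n = 5 via elliptic fibrations): base change of the rational elliptic surface
  `y² = x³ + a₁x + a₂` (`deg aᵢ ≤ i`) by `t = p_{5,a}(s)` gives a 4-dimensional family with very
  general `ρ = 6` and, "by Proposition 4.6, `ℚ(√5) ⊂ End_Hdg(T_{X_a,ℚ})` … this is an equality very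
  generally".
* **Thm. 1.2**: "(2) The 4-dimensional family of elliptic K3 surfaces in Proposition 6.2 has `ρ = 10`
  and RM by `ℚ(√2)`. (3) The 3-dimensional family of elliptic K3 surfaces in Proposition 7.2 has
  `ρ = 10` and RM by `ℚ(√3)`." Mechanism (§6 "K3 surfaces with RM (induced by suitable rational
  self-maps)", proof 6.4, Rem. 6.3, §7.3): a fibrewise `2`- (resp. `3`-) isogeny `ψ : X → X'` composed
  with an isomorphism `φ' : X' ≅ X` twisting the base by `t ↦ -t` is a dominant rational self-map of
  degree `2` (resp. `3`) of `X` acting on the `2`-form `ω` by `√2` (resp. a real number of square `3`);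
  its graph is the algebraic cycle inducing the real multiplication; very general `ρ = 10` by
  Shioda–Tate (`NS ⊃ U ⊕ A₁⁸`, resp. `U ⊕ A₂⁴`) and §7.4 (point count at `p = 7`).

## Lean rendering (D-0014 named facts; consumer: line `cm-anchor-spread` on crux
`PicardThreeK3Squares` of route MarkmanPartnerTransport, rung `SquareOfGenerator`)

The tree has no vocabulary for Weierstrass models / elliptic K3 surfaces / Dickson covers, so the
MEMBERS of these families cannot be named; what the tree can carry faithfully is the EXISTENCE of
(very general) members with the printed invariants — an explicit gap (the families are positive
dimensional: 7, 3, 2, 2, 4, 4, 3 moduli), not a weakening of the members' properties. Each fact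
below asserts: there is a K3 surface `S` (`IsK3Surface`) with the printed very general Picard number
`ρ = dim_ℂ N¹H²(S(ℂ); ℂ)` (`Module.finrank ℂ (algebraicClasses S 1)`), NOT of CM type
(`¬ HasComplexMultiplication S`: `F` is totally real), and a `ℂ`-linear endomorphism `t` of
`H²(S(ℂ); ℂ)` which

* (`IsCycleInducedTranscendentalEndomorphism S hS t`) preserves rational classes and Hodge types,
  vanishes on `N = N¹H²` (= `NS(S) ⊗ ℂ`), has image in `T = N^⊥`, and is INDUCED BY AN ALGEBRAIC
  CLASS `γ ∈ algebraicClasses (S ⊗ S) 2` as the correspondence `t = [γ]_* = fst_* (snd^* (–) ∪ γ)`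
  for the complex orientations (`HodgeTheory.complexGysin complexOrientationFamily`; LITERALLY the
  expression of `Buskin2019_hodgeIsometry_algebraic` and of the consumer's `SquareOfGenerator`);
* (`IsAnnihilatedOnTranscendentalBy S t P`) satisfies `P(t) = 0` on `T`, `P` the minimal polynomial
  of the printed generator (`ζ_n + ζ_n⁻¹ = 2cos(2π/n)`: `X² + X - 1`, `X³ + X² - 2X - 1`,
  `X³ - 3X + 1`, `X⁵ + X⁴ - 4X³ - 3X² + 3X + 1` for `n = 5, 7, 9, 11`; `X² - 2`, `X² - 3` for the
  self-maps), all irreducible over `ℚ`, so `ℚ[t|_T] ≅ ℚ[X]/(P) = F` (as `T ≠ 0`);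
* (`TranscendentalEndomorphismsGeneratedBy S t`) generates ALL rational Hodge endomorphisms of `T`
  extended by `0` on `N`: `End_Hdg(T_{S,ℚ}) = ℚ[t|_T]` — i.e. `F = End_Hdg(T_{S,ℚ})` EXACTLY (very
  general member), in the spelling of the consumer's `GeneratesClause`.

Normal form. The paper's cycle `γ₀` (image of `Γ₁ + Γ₋₁`, resp. the graph of the self-map) induces an
endomorphism `[γ₀]_*` of `H²(S, ℚ)` whose restriction to `T` is the generator (`2(ζ_n + ζ_n⁻¹)` after
the degree-`2` transfer, resp. `±√2`, `±√3`); the endomorphism `t` above is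
`c · [γ₀]_* ∘ π_T` (`c ∈ ℚˣ`), where `π_T = [Δ_S] - Σᵢ [Dᵢ × Dᵢ^∨]` (`Dᵢ` a basis of `NS(S)_ℚ`, `Dᵢ^∨` the
dual basis for the non-degenerate intersection form) is the algebraic projector onto `T` — the
standard identification `End_Hdg(T) ↪ End_Hdg(H²)` by extension by zero used throughout the tree
(`K3ComplexMultiplication`), algebraic classes being stable under composition of correspondences
(Fulton, Prop. 16.1.1; in the tree `HodgeTheory/CorrespondenceComposition`,
`Surfaces/K3CorrespondenceComposition`) and `algebraicClasses` being a `ℂ`-subspace.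
[cite: Fulton1998, §16.1 Prop. 16.1.1] [cite: KahnMurrePedrini2007, §7.2.2 (the projectors
`π₂^{alg}`, `π₂^{tr} = π₂ - π₂^{alg}`)]

Not typed: Thm. 1.1 (5) itself (degree-`2` K3 surfaces, `ρ = 2`, §5.9 — the cycle statement §4.8
is printed for the elliptic construction of Prop. 4.6, whose `n = 5` instance is the `ρ = 6` family
of §5.2 typed here); the abstract existence theorems Thm. 3.x (maximal RM families via Taelman /
lattice theory, no cycles); the isolated `ρ = 16` example with RM by `ℚ(√7)` (§7.6); the CM families
and higher CM strata (§6.7). TODO(general form): once elliptic K3 surfaces with Weierstrass models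
are in the tree, restate the facts for EVERY member `𝓔_a` (`a ≠ 0`) of the families.

## References

* [GeemenSchutt2023] B. van Geemen, M. Schütt, On families of K3 surfaces with real multiplication,
  Forum Math. Sigma 13 (2025) e2, arXiv:2310.05196: Thm. 1.1, Thm. 1.2, §2.1, Lemma 4.3, Prop. 4.6,
  §4.8, Rem. 4.9, §5.2, §5.4, §5.6, §5.8, Prop. 6.2, Rem. 6.3, §6.4, Prop. 7.2, §7.3–7.4.
* [Zarhin1983HodgeGroupsK3] Yu. G. Zarhin, Hodge groups of K3 surfaces, J. reine angew. Math. 341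
  (1983), Thm. 1.5.1.
* [Fulton1998] W. Fulton, Intersection Theory, 2nd ed., Springer 1998, §16.1 Prop. 16.1.1.
* [KahnMurrePedrini2007] B. Kahn, J. P. Murre, C. Pedrini, On the transcendental part of the motive
  of a surface, in: Algebraic Cycles and Motives II, LMS LNS 344, CUP 2007, §7.2.2.
* [Huybrechts2016K3] D. Huybrechts, Lectures on K3 Surfaces, CUP 2016, Ch. 3 Lemma 3.3.1,
  Thm. 3.3.7.
-/

noncomputable section

open CategoryTheory MonoidalCategory Polynomial
open Literature.AlgebraicTopology.SingularHomology
open Literature.AlgebraicGeometry.HodgeTheory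

namespace Literature.AlgebraicGeometry.Surfaces

variable {S : Motives.SchemeOver ℂ}

/-! ### The three clauses (consumer normal form) -/

/-- **`t` is a transcendental Hodge endomorphism of `H²(S(ℂ); ℂ)` induced by an algebraic cycle on
`S × S`** (`S` a smooth projective surface): `t` preserves rational classes and every Hodge type
`(i, j)`, vanishes on `N = N¹H²(S(ℂ); ℂ) = algebraicClasses S 1`, has image cup-orthogonal to `N`
(i.e. in `T = N^⊥`), and there is an algebraic class `γ ∈ algebraicClasses (S ⊗ S) 2` with
`t = [γ]_* = fst_* (snd^* (–) ∪ γ)` (Gysin morphism of `fst : S ⊗ S ⟶ S` for the complex orientation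
family) — the element `t|_T ∈ End_Hdg(T_{S,ℚ})` extended by `0` on `N` "is induced by an algebraic
cycle on `S × S`" (loc. cit. §4.8), in the correspondence spelling of
`Buskin2019_hodgeIsometry_algebraic`. The value does not depend on the proof `hS`.
[cite: GeemenSchutt2023, §4.8 and §2.1] [cite: Fulton1998, §16.1 Prop. 16.1.1] -/
def IsCycleInducedTranscendentalEndomorphism (S : Motives.SchemeOver ℂ)
    (hS : Motives.IsSmoothProjective 2 S)
    (t : complexBetti S (2 * 1) →ₗ[ℂ] complexBetti S (2 * 1)) : Prop :=
  (∀ y, IsRationalClass y → IsRationalClass (t y)) ∧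
  (∀ (i j : ℕ) (y : complexBetti S (2 * 1)),
      IsOfHodgeType 2 S (2 * 1) i j y → IsOfHodgeType 2 S (2 * 1) i j (t y)) ∧
  (∀ d ∈ algebraicClasses S 1, t d = 0) ∧
  (∀ (y : complexBetti S (2 * 1)), ∀ d ∈ algebraicClasses S 1,
      cupProduct (rfl : 2 * 1 + 2 * 1 = 2 * 2) (t y) d = 0) ∧
  ∃ γ ∈ algebraicClasses (S ⊗ S) 2, ∀ y : complexBetti S (2 * 1),
    t y = complexGysin complexOrientationFamily (Motives.IsSmoothProjective.tensor_holds hS hS) hS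
      (SemiCartesianMonoidalCategory.fst S S)
      (rfl : 2 * 1 + 2 * 2 + 2 * 2 = 2 * 1 + 2 * (2 + 2))
      (cupProduct (rfl : 2 * 1 + 2 * 2 = 2 * 1 + 2 * 2)
        (complexBetti.map (SemiCartesianMonoidalCategory.snd S S) (2 * 1) y) γ)

/-- Unfolding of `IsCycleInducedTranscendentalEndomorphism`. [cite: GeemenSchutt2023, §4.8] -/
theorem isCycleInducedTranscendentalEndomorphism_iff (hS : Motives.IsSmoothProjective 2 S)
    (t : complexBetti S (2 * 1) →ₗ[ℂ] complexBetti S (2 * 1)) :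
    IsCycleInducedTranscendentalEndomorphism S hS t ↔
      (∀ y, IsRationalClass y → IsRationalClass (t y)) ∧
      (∀ (i j : ℕ) (y : complexBetti S (2 * 1)),
          IsOfHodgeType 2 S (2 * 1) i j y → IsOfHodgeType 2 S (2 * 1) i j (t y)) ∧
      (∀ d ∈ algebraicClasses S 1, t d = 0) ∧
      (∀ (y : complexBetti S (2 * 1)), ∀ d ∈ algebraicClasses S 1,
          cupProduct (rfl : 2 * 1 + 2 * 1 = 2 * 2) (t y) d = 0) ∧
      ∃ γ ∈ algebraicClasses (S ⊗ S) 2, ∀ y : complexBetti S (2 * 1),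
        t y = complexGysin complexOrientationFamily (Motives.IsSmoothProjective.tensor_holds hS hS)
          hS (SemiCartesianMonoidalCategory.fst S S)
          (rfl : 2 * 1 + 2 * 2 + 2 * 2 = 2 * 1 + 2 * (2 + 2))
          (cupProduct (rfl : 2 * 1 + 2 * 2 = 2 * 1 + 2 * 2)
            (complexBetti.map (SemiCartesianMonoidalCategory.snd S S) (2 * 1) y) γ) :=
  Iff.rfl

namespace IsCycleInducedTranscendentalEndomorphism

variable {hS : Motives.IsSmoothProjective 2 S} {t : complexBetti S (2 * 1) →ₗ[ℂ] complexBetti S (2 * 1)}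

/-- A cycle-induced transcendental endomorphism preserves rational classes. [cite: GeemenSchutt2023, §4.8] -/
theorem isRationalClass_map (h : IsCycleInducedTranscendentalEndomorphism S hS t)
    {y : complexBetti S (2 * 1)} (hy : IsRationalClass y) : IsRationalClass (t y) :=
  h.1 y hy

/-- A cycle-induced transcendental endomorphism vanishes on `N¹H²`. [cite: GeemenSchutt2023, §4.8] -/
theorem map_eq_zero_of_mem (h : IsCycleInducedTranscendentalEndomorphism S hS t)
    {d : complexBetti S (2 * 1)} (hd : d ∈ algebraicClasses S 1) : t d = 0 :=
  h.2.2.1 d hd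

/-- A cycle-induced transcendental endomorphism is the correspondence of an algebraic class on
`S × S`. [cite: GeemenSchutt2023, §4.8] -/
theorem exists_mem_algebraicClasses (h : IsCycleInducedTranscendentalEndomorphism S hS t) :
    ∃ γ ∈ algebraicClasses (S ⊗ S) 2, ∀ y : complexBetti S (2 * 1),
      t y = complexGysin complexOrientationFamily (Motives.IsSmoothProjective.tensor_holds hS hS) hS
        (SemiCartesianMonoidalCategory.fst S S)
        (rfl : 2 * 1 + 2 * 2 + 2 * 2 = 2 * 1 + 2 * (2 + 2))
        (cupProduct (rfl : 2 * 1 + 2 * 2 = 2 * 1 + 2 * 2)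
          (complexBetti.map (SemiCartesianMonoidalCategory.snd S S) (2 * 1) y) γ) :=
  h.2.2.2.2

end IsCycleInducedTranscendentalEndomorphism

/-- **`P(t) = 0` on the transcendental part**: for every class `y ∈ T = (N¹H²)^⊥` (cup-orthogonal to
`algebraicClasses S 1`), `P(t) y = 0`, where `P ∈ ℚ[X]` is evaluated on the `ℂ`-linear endomorphism
`t` (`Polynomial.aeval t (P.map (algebraMap ℚ ℂ))`). With `P` irreducible and `T ≠ 0` this says
`ℚ[t|_T] ≅ ℚ[X]/(P)`, the number field generated by the printed generator.
[cite: GeemenSchutt2023, §2.1 and Prop. 4.6] -/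
def IsAnnihilatedOnTranscendentalBy (S : Motives.SchemeOver ℂ)
    (t : complexBetti S (2 * 1) →ₗ[ℂ] complexBetti S (2 * 1)) (P : ℚ[X]) : Prop :=
  ∀ y : complexBetti S (2 * 1),
    (∀ d ∈ algebraicClasses S 1, cupProduct (rfl : 2 * 1 + 2 * 1 = 2 * 2) y d = 0) →
      Polynomial.aeval t (P.map (algebraMap ℚ ℂ)) y = 0

/-- Unfolding of `IsAnnihilatedOnTranscendentalBy`. [cite: GeemenSchutt2023, §2.1] -/
theorem isAnnihilatedOnTranscendentalBy_iff (t : complexBetti S (2 * 1) →ₗ[ℂ] complexBetti S (2 * 1))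
    (P : ℚ[X]) :
    IsAnnihilatedOnTranscendentalBy S t P ↔
      ∀ y : complexBetti S (2 * 1),
        (∀ d ∈ algebraicClasses S 1, cupProduct (rfl : 2 * 1 + 2 * 1 = 2 * 2) y d = 0) →
          Polynomial.aeval t (P.map (algebraMap ℚ ℂ)) y = 0 :=
  Iff.rfl

/-- **`End_Hdg(T_{S,ℚ}) = ℚ[t|_T]`**: every `ℂ`-linear endomorphism `f` of `H²(S(ℂ); ℂ)` preserving
rational classes and Hodge types, vanishing on `N = algebraicClasses S 1` and with image
cup-orthogonal to `N` (i.e. every rational Hodge endomorphism of `T` extended by `0` on `N`) is a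
RATIONAL polynomial in `t` on `T`: `f y = Σᵢ aᵢ tⁱ y` for `y ∈ T`, `aᵢ ∈ ℚ`. For a K3 surface this
says `F = End_Hdg(T_{S,ℚ}) = ℚ[t|_T]` ("the very general member `X` in the family has
`F = End_Hdg(T_{X,ℚ})`", §1); VERBATIM the clause `GeneratesClause S t` of the consumer.
[cite: GeemenSchutt2023, §1 (definition of RM by `F`) and §2.1] [cite: Zarhin1983HodgeGroupsK3, Thm. 1.5.1] -/
def TranscendentalEndomorphismsGeneratedBy (S : Motives.SchemeOver ℂ)
    (t : complexBetti S (2 * 1) →ₗ[ℂ] complexBetti S (2 * 1)) : Prop :=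
  ∀ (f : complexBetti S (2 * 1) →ₗ[ℂ] complexBetti S (2 * 1)),
    (∀ y, IsRationalClass y → IsRationalClass (f y)) →
    (∀ (i j : ℕ) (y : complexBetti S (2 * 1)),
        IsOfHodgeType 2 S (2 * 1) i j y → IsOfHodgeType 2 S (2 * 1) i j (f y)) →
    (∀ d ∈ algebraicClasses S 1, f d = 0) →
    (∀ (y : complexBetti S (2 * 1)), ∀ d ∈ algebraicClasses S 1,
        cupProduct (rfl : 2 * 1 + 2 * 1 = 2 * 2) (f y) d = 0) →
    ∃ (n : ℕ) (a : Fin n → ℚ), ∀ y : complexBetti S (2 * 1),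
      (∀ d ∈ algebraicClasses S 1, cupProduct (rfl : 2 * 1 + 2 * 1 = 2 * 2) y d = 0) →
        f y = ∑ i, (a i : ℂ) • (t ^ (i : ℕ)) y

/-- Unfolding of `TranscendentalEndomorphismsGeneratedBy`. [cite: GeemenSchutt2023, §1 and §2.1] -/
theorem transcendentalEndomorphismsGeneratedBy_iff
    (t : complexBetti S (2 * 1) →ₗ[ℂ] complexBetti S (2 * 1)) :
    TranscendentalEndomorphismsGeneratedBy S t ↔
      ∀ (f : complexBetti S (2 * 1) →ₗ[ℂ] complexBetti S (2 * 1)),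
        (∀ y, IsRationalClass y → IsRationalClass (f y)) →
        (∀ (i j : ℕ) (y : complexBetti S (2 * 1)),
            IsOfHodgeType 2 S (2 * 1) i j y → IsOfHodgeType 2 S (2 * 1) i j (f y)) →
        (∀ d ∈ algebraicClasses S 1, f d = 0) →
        (∀ (y : complexBetti S (2 * 1)), ∀ d ∈ algebraicClasses S 1,
            cupProduct (rfl : 2 * 1 + 2 * 1 = 2 * 2) (f y) d = 0) →
        ∃ (n : ℕ) (a : Fin n → ℚ), ∀ y : complexBetti S (2 * 1),
          (∀ d ∈ algebraicClasses S 1, cupProduct (rfl : 2 * 1 + 2 * 1 = 2 * 2) y d = 0) →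
            f y = ∑ i, (a i : ℂ) • (t ^ (i : ℕ)) y :=
  Iff.rfl

/-- **A K3 surface with real multiplication by `ℚ[X]/(P)`, of Picard number `ρ`, whose generator is
induced by an algebraic cycle** — the common shape of the six facts below: `S` is a K3 surface with
`dim_ℂ N¹H²(S(ℂ); ℂ) = ρ`, not of CM type, carrying a cycle-induced transcendental endomorphism `t`
with `P(t) = 0` on `T` and `End_Hdg(T_{S,ℚ}) = ℚ[t|_T]`.
[cite: GeemenSchutt2023, §1, §2.1, §4.8] -/
def IsCycleInducedRMK3 (S : Motives.SchemeOver ℂ) (ρ : ℕ) (P : ℚ[X]) : Prop :=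
  ∃ hS : IsK3Surface S,
    Module.finrank ℂ ↥(algebraicClasses S 1) = ρ ∧ ¬ HasComplexMultiplication S ∧
    ∃ t : complexBetti S (2 * 1) →ₗ[ℂ] complexBetti S (2 * 1),
      IsCycleInducedTranscendentalEndomorphism S hS.isSmoothProjective t ∧
      IsAnnihilatedOnTranscendentalBy S t P ∧
      TranscendentalEndomorphismsGeneratedBy S t

/-- Unfolding of `IsCycleInducedRMK3`. [cite: GeemenSchutt2023, §1 and §4.8] -/
theorem isCycleInducedRMK3_iff (S : Motives.SchemeOver ℂ) (ρ : ℕ) (P : ℚ[X]) :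
    IsCycleInducedRMK3 S ρ P ↔
      ∃ hS : IsK3Surface S,
        Module.finrank ℂ ↥(algebraicClasses S 1) = ρ ∧ ¬ HasComplexMultiplication S ∧
        ∃ t : complexBetti S (2 * 1) →ₗ[ℂ] complexBetti S (2 * 1),
          IsCycleInducedTranscendentalEndomorphism S hS.isSmoothProjective t ∧
          IsAnnihilatedOnTranscendentalBy S t P ∧
          TranscendentalEndomorphismsGeneratedBy S t :=
  Iff.rfl

namespace IsCycleInducedRMK3

variable {ρ : ℕ} {P : ℚ[X]}

/-- An RM K3 surface in the sense above is a K3 surface. [cite: GeemenSchutt2023, Thm. 1.1] -/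
theorem isK3Surface (h : IsCycleInducedRMK3 S ρ P) : IsK3Surface S :=
  h.1

/-- … of Picard number `ρ`. [cite: GeemenSchutt2023, Thm. 1.1] -/
theorem finrank_algebraicClasses_one (h : IsCycleInducedRMK3 S ρ P) :
    Module.finrank ℂ ↥(algebraicClasses S 1) = ρ :=
  h.2.1

/-- … not of CM type (its endomorphism field is totally real). [cite: GeemenSchutt2023, §2.1] -/
theorem not_hasComplexMultiplication (h : IsCycleInducedRMK3 S ρ P) : ¬ HasComplexMultiplication S :=
  h.2.2.1

/-- … and carries a cycle-induced transcendental endomorphism `t` with `P(t) = 0` on `T` generating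
`End_Hdg(T)` — the input of the consumer's `SquareOfGenerator` (smoothness witness, rationality,
vanishing on `N¹`, an algebraic class inducing `t`, and the generation clause).
[cite: GeemenSchutt2023, §4.8] -/
theorem exists_generator (h : IsCycleInducedRMK3 S ρ P) :
    ∃ (hS : Motives.IsSmoothProjective 2 S) (t : complexBetti S (2 * 1) →ₗ[ℂ] complexBetti S (2 * 1)),
      IsCycleInducedTranscendentalEndomorphism S hS t ∧ IsAnnihilatedOnTranscendentalBy S t P ∧
        TranscendentalEndomorphismsGeneratedBy S t := by
  obtain ⟨hS, -, -, t, ht, hP, hgen⟩ := h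
  exact ⟨hS.isSmoothProjective, t, ht, hP, hgen⟩

/-- **Consumption (the rung `SquareOfGenerator` of line `cm-anchor-spread`, crux `PicardThreeK3Squares`):**
granted the bookkeeping statement "a cycle-induced transcendental endomorphism `t` generating
`End_Hdg(T)` gives the Hodge conjecture for `S × S`" (hypothesis `hF4`, LITERALLY the consumer's
`SquareOfGenerator` with its `GeneratesClause` — powers of an algebraic self-correspondence are
algebraic, Fulton Prop. 16.1.1, and Künneth bookkeeping), an RM K3 surface in the sense above has
`HodgeConjectureFor 4 (S ⊗ S)`: real-multiplication K3 squares OUTSIDE the Kuga–Satake / CM sector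
(loc. cit. Rem. 4.9: "Assuming the Hodge conjecture, there must be a cycle inducing the RM").
[cite: GeemenSchutt2023, §4.8 and Rem. 4.9] [cite: Fulton1998, §16.1 Prop. 16.1.1] -/
theorem hodgeConjectureFor_tensor_self_of (h : IsCycleInducedRMK3 S ρ P)
    (hF4 : ∀ (S : Motives.SchemeOver ℂ) (hS : Motives.IsSmoothProjective 2 S)
      (t : complexBetti S (2 * 1) →ₗ[ℂ] complexBetti S (2 * 1)),
      (∀ y, IsRationalClass y → IsRationalClass (t y)) →
      (∀ d ∈ algebraicClasses S 1, t d = 0) →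
      (∃ γ ∈ algebraicClasses (S ⊗ S) 2, ∀ y : complexBetti S (2 * 1),
        t y = complexGysin complexOrientationFamily (Motives.IsSmoothProjective.tensor_holds hS hS)
          hS (SemiCartesianMonoidalCategory.fst S S)
          (rfl : 2 * 1 + 2 * 2 + 2 * 2 = 2 * 1 + 2 * (2 + 2))
          (cupProduct (rfl : 2 * 1 + 2 * 2 = 2 * 1 + 2 * 2)
            (complexBetti.map (SemiCartesianMonoidalCategory.snd S S) (2 * 1) y) γ)) →
      TranscendentalEndomorphismsGeneratedBy S t →
      HodgeConjectureFor 4 (S ⊗ S)) :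
    HodgeConjectureFor 4 (S ⊗ S) := by
  obtain ⟨hS, -, -, t, ht, -, hgen⟩ := h
  obtain ⟨hrat, -, hNS, -, γ, hγ, hcorr⟩ := ht
  exact hF4 S hS.isSmoothProjective t hrat hNS ⟨γ, hγ, hcorr⟩ hgen

end IsCycleInducedRMK3

/-! ### The dihedral (Dickson-polynomial) families: Thm. 1.1 with §4.8 -/

/-- **van Geemen–Schütt, Thm. 1.1 (7) with Prop. 4.6, §4.8 and §5.4: an elliptic K3 surface of Picard
number `4` with real multiplication by the cubic field `ℚ(ζ₇ + ζ₇⁻¹)` whose generator is induced by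
an algebraic cycle.** "(7) The 3-dimensional family of elliptic K3 surfaces in §5.4
[`y² = x³ + (b₁ p_{7,a}(t) + b₀)x + (c₁ p_{7,a}(t) + c₀)`, very general `Pic = U ⊕ K₇`] has `ρ = 4`
and RM by the cubic field `ℚ(ζ₇ + ζ₇⁻¹)`"; §4.8: "the action of `ζ_n + ζ_n⁻¹` on `H²(𝓔̃_a, ℚ)` is
induced by the cycle `Γ₁ + Γ₋₁` … This cycle induces one on `𝓔_a × 𝓔_a` which defines the real
multiplication on `T_{X,ℚ}`." Typed for a very general member (existence), with
`P = X³ + X² - 2X - 1`, the minimal polynomial of `ζ₇ + ζ₇⁻¹`; see the module docstring for the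
normal form. [cite: GeemenSchutt2023, Thm. 1.1 (7), Prop. 4.6, §4.8, §5.4] -/
def VanGeemenSchuett2025_rmK3_cycleInduced_zeta7 : Prop :=
  ∃ S : Motives.SchemeOver ℂ, IsCycleInducedRMK3 S 4 (X ^ 3 + X ^ 2 - 2 * X - 1)

/-- **van Geemen–Schütt, Thm. 1.1 (9) with §4.8 and §5.6: an elliptic K3 surface of Picard number `10`
with real multiplication by the cubic field `ℚ(ζ₉ + ζ₉⁻¹)` whose generator is induced by an
algebraic cycle.** "(9) The 2-dimensional family of elliptic K3 surfaces in §5.6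
[`y² = x³ + bx + c₁ p_{9,a}(t) + c₀`, very general `Pic = U ⊕ A₂⁴`] has `ρ = 10` and RM by the cubic
field `ℚ(ζ₉ + ζ₉⁻¹)`" (§5.6: "one modifies the proof of Proposition 4.6 by splitting `H²(𝓔̃_a, ℚ)`
into three summands …"; cycle `Γ₁ + Γ₋₁` of §4.8). Typed for a very general member, with
`P = X³ - 3X + 1`, the minimal polynomial of `ζ₉ + ζ₉⁻¹`.
[cite: GeemenSchutt2023, Thm. 1.1 (9), §4.8, §5.6] -/
def VanGeemenSchuett2025_rmK3_cycleInduced_zeta9 : Prop :=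
  ∃ S : Motives.SchemeOver ℂ, IsCycleInducedRMK3 S 10 (X ^ 3 - 3 * X + 1)

/-- **van Geemen–Schütt, Thm. 1.1 (11) with Prop. 4.6, §4.8 and §5.8: an elliptic K3 surface of Picard
number `2` with real multiplication by the quintic field `ℚ(ζ₁₁ + ζ₁₁⁻¹)` whose generator is induced
by an algebraic cycle.** "(11) The 2-dimensional family of elliptic K3 surfaces in §5.8
[`y² = x³ + bx + (c₁ p_{11,a}(t) + c₀)`, very general `Pic = U`, `T = U² ⊕ E₈²`] has `ρ = 2` and RM
by the degree five field `ℚ(ζ₁₁ + ζ₁₁⁻¹)`"; cycle `Γ₁ + Γ₋₁` of §4.8. Typed for a very general member,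
with `P = X⁵ + X⁴ - 4X³ - 3X² + 3X + 1`, the minimal polynomial of `ζ₁₁ + ζ₁₁⁻¹`.
[cite: GeemenSchutt2023, Thm. 1.1 (11), Prop. 4.6, §4.8, §5.8] -/
def VanGeemenSchuett2025_rmK3_cycleInduced_zeta11 : Prop :=
  ∃ S : Motives.SchemeOver ℂ,
    IsCycleInducedRMK3 S 2 (X ^ 5 + X ^ 4 - 4 * X ^ 3 - 3 * X ^ 2 + 3 * X + 1)

/-- **van Geemen–Schütt, §5.2 with Prop. 4.6 and §4.8 (the case `n = 5` via elliptic fibrations): an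
elliptic K3 surface of Picard number `6` with real multiplication by `ℚ(√5) = ℚ(ζ₅ + ζ₅⁻¹)` whose
generator is induced by an algebraic cycle.** §5.2: the base change `X_a` of the rational elliptic
surface `y² = x³ + a₁x + a₂` (`deg aᵢ ≤ i`) by `t = p_{5,a}(s)` is "a 4-dimensional family of K3
surfaces with the same very general Néron–Severi lattice [`ρ = 6`: `NS ⊃ U ⊕ A₂`,
`MWL ⊇ A₂^∨(5)`]. By Proposition 4.6, one has `ℚ(√5) ⊂ End_Hdg(T_{X_a,ℚ})` … this is an equality
very generally"; cycle `Γ₁ + Γ₋₁` of §4.8. Typed for a very general member, with `P = X² + X - 1`, the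
minimal polynomial of `ζ₅ + ζ₅⁻¹ = (√5 - 1)/2`. (Thm. 1.1 (5) — degree-`2` K3 surfaces, `ρ = 2`,
§5.9 — is a different, `D₅`-cover-of-`𝔽₁ → 𝔽₅` construction and is not typed here.)
[cite: GeemenSchutt2023, §5.2, Prop. 4.6, §4.8] -/
def VanGeemenSchuett2025_rmK3_cycleInduced_sqrt5 : Prop :=
  ∃ S : Motives.SchemeOver ℂ, IsCycleInducedRMK3 S 6 (X ^ 2 + X - 1)

/-! ### The isogeny families: Thm. 1.2 (rational self-maps) -/

/-- **van Geemen–Schütt, Thm. 1.2 (2) with Prop. 6.2, Rem. 6.3 and §6.4: an elliptic K3 surface of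
Picard number `10` with real multiplication by `ℚ(√2)` induced by a rational self-map of degree `2`.**
"(2) The 4-dimensional family of elliptic K3 surfaces in Proposition 6.2
[`y² = x(x² + 2tα(t²)x + ½t²α(t²)² + tβ(t²))`, `deg α ≤ 1`, `deg β ≤ 3`] has `ρ = 10` and RM by `ℚ(√2)`";
§6.4: the fibrewise `2`-isogeny `ψ` composed with `φ' : X' ≅ X`, `(u,v,t) ↦ (2x, 2√2 y, -t)`, is a
degree-`2` self-map `φ' ∘ ψ` of `X` and "`ℚ(√2) ⊂ End_Hdg(T_X)` by inspection of the degree `2` self-map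
`φ' ∘ ψ` of `X` and its induced action on `ω`" (its graph is the algebraic cycle); "very generally
`ρ = 10` [`NS ⊃ U ⊕ A₁⁸`] and … RM by `ℚ(√2)`". Typed for a very general member, with `P = X² - 2`.
[cite: GeemenSchutt2023, Thm. 1.2 (2), Prop. 6.2, Rem. 6.3, §6.4] -/
def VanGeemenSchuett2025_rmK3_cycleInduced_sqrt2 : Prop :=
  ∃ S : Motives.SchemeOver ℂ, IsCycleInducedRMK3 S 10 (X ^ 2 - 2)

/-- **van Geemen–Schütt, Thm. 1.2 (3) with Prop. 7.2 and §7.3–7.4: an elliptic K3 surface of Picard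
number `10` with real multiplication by `ℚ(√3)` induced by a rational self-map of degree `3`.**
"(3) The 3-dimensional family of elliptic K3 surfaces in Proposition 7.2
[`y² = x³ + 27a(x - 4b)²`, `a = tα(t²)`, `b = -a/2 + β(t²)`, `deg α ≤ 1`, `deg β ≤ 2`] has `ρ = 10` and
RM by `ℚ(√3)`" (Prop. 7.2 (2): "`ρ ≥ 10` [`NS ⊃ U ⊕ A₂⁴`] and RM by `ℚ(√3)`", by the degree-`3` isogeny
self-map as in §6.4; §7.4: `ρ = 10` very generally, from `ρ(X ⊗ 𝔽̄₇) = 10` for `α = 1 + 2t`,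
`β = 3 + 4t + t²`, read off the zeta function by Tate's theorem for elliptic K3 surfaces over finite
fields). Typed for a very general member, with `P = X² - 3`.
[cite: GeemenSchutt2023, Thm. 1.2 (3), Prop. 7.2, §7.3, §7.4] -/
def VanGeemenSchuett2025_rmK3_cycleInduced_sqrt3 : Prop :=
  ∃ S : Motives.SchemeOver ℂ, IsCycleInducedRMK3 S 10 (X ^ 2 - 3)

/-! ### Thm. 1.1 (5): the degree-`2` family of §5.9 (`D₅`-cover of `𝔽₁ → 𝔽₅`) -/

/-- **van Geemen–Schütt, Thm. 1.1 (5) with §5.9, Prop. 4.6 and §4.8: a K3 surface of Picard number `2`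
(a deformed double plane) with real multiplication by `ℚ(√5) = ℚ(ζ₅ + ζ₅⁻¹)` whose generator is
induced by an algebraic cycle.** Thm. 1.1: "(5) The 7-dimensional family of degree 2 K3 surfaces in
§5.9 has `ρ = 2` and RM by `ℚ(√5) = ℚ(ζ₅ + ζ₅⁻¹)`." §5.9 (proof of Thm. 1.1 (5)): the members `𝒜_p` of
the Artebani–Sarti–Taki family 5A are the double planes branched along `C_p : p(x₀,x₁) + x₁x₂⁵ = 0`
with the order-`5` non-symplectic automorphism induced by `(x₀:x₁:x₂) ↦ (x₀:x₁:ζ₅x₂)` ("The general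
member in the family `𝒜` has Picard rank two"); "We deform the family `𝒜` by replacing `x₂⁵` … by the
Dickson polynomial `p_{5,a}(x₂)` where `a ∈ ℂ[x₀, x₁]` is homogeneous of degree two … One obtains a
covering map `𝔽₁ → 𝔽₅` with monodromy group `D₅`. This induces a degree five covering between the
double covers and similar to the proof of Proposition 4.6 one finds that any `𝒜_p` deforms to a K3
with RM by `ℚ(√5)` … Since these K3 surfaces have Picard number `2` …". The real multiplication is
the endomorphism `σ^* + (σ⁻¹)^*` descended from the `D₅`-Galois cover exactly as in the proof of
Prop. 4.6, and §4.8 ("Cycles inducing the real multiplication": "`[Γ_k]_2 = (σ^{-k})^*` … the action of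
`ζ_n + ζ_n⁻¹` … is induced by the cycle `Γ₁ + Γ₋₁` … This cycle induces one on `𝓔_a × 𝓔_a` which
defines the real multiplication on `T_{X,ℚ}`") is the graph-cycle computation for that descent — it
uses only that `σ` is an automorphism of the Galois cover and push-forward of algebraic cycles along the
finite quotient map, so it applies verbatim to the `D₅`-cover of §5.9 (Rem. 4.9: RM "induced by a cycle
with two irreducible components as we found"). Typed, like the sibling facts of this file, for a very
general member (existence), with `P = X² + X - 1`, the minimal polynomial of `ζ₅ + ζ₅⁻¹`; see the module
docstring for the normal form `t = c · [γ₀]_* ∘ π_T`. This is the `ρ = 2` companion of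
`VanGeemenSchuett2025_rmK3_cycleInduced_sqrt5` (the `ρ = 6` elliptic family of §5.2) and supersedes
the module docstring's remark that Thm. 1.1 (5) is not typed. Consumer: the model EXAMPLE inside the
regime of crux `LowPicardRealMultiplication` of route MarkmanPartnerTransport (the Hilbert square
`S^{[2]}`, `ρ = 3`, `E = ℚ(√5)`, cell hodge-nonav, memo ROUTE-P1AJ §C.5–§C.6).
[cite: GeemenSchutt2023, Thm. 1.1 (5), §5.9, Prop. 4.6, §4.8, Rem. 4.9] -/
def VanGeemenSchuett2025_rmK3_cycleInduced_sqrt5_degreeTwo : Prop :=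
  ∃ S : Motives.SchemeOver ℂ, IsCycleInducedRMK3 S 2 (X ^ 2 + X - 1)

end Literature.AlgebraicGeometry.Surfaces

end
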